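/-
Origin: expansion seat `prover-pub-hodgecm-mc-sinst-1-g11-0`, handover #1275 2026-08-21T04:53Z md5 52ed2b8be09a (131 l.; NEW additive leaf, ns HodgeCM.Model.ArchSideTerm; § 1 etaT₀∕₁∕₂∕₃_apply_one_snd (etaT_k η ν (1,u) = eta_k η (1,u): the V-twists ν ∕ ν' drop out on 1 × U(1)); § 2 torusScalar_{zero,one,two,three}G_etaT_detTwist_apply : torusScalar_kG … (etaT_k (cmDetTwistChar … χV χW) ν) u = χW u · χ_k(1, CMCenter u) (carch torusScalar_k_applyG + eta_k_detTwist_apply); § 3 torusScalar_{zero,one,two,three}G_etaT_detTwist_eq_mul_of_chiW : … χW … u = χW u · (χW' u)⁻¹ · … χW' … u (χ_W-COVARIANCE; complements own-mu #MU3's χ_W-freeness of lineCharV_k); cert rc 0 ∕ 25 s; NAMES for audit: HodgeCM.Model.ArchSideTerm.torusScalar_zeroG_etaT_detTwist_apply · HodgeCM.Model.ArchSideTerm.torusScalar_twoG_etaT_detTwist_apply · HodgeCM.Model.ArchSideTerm.torusScalar_oneG_etaT_detTwist_eq_mul_of_chiW) (`HOME/mc/pub-hodgecm-mc-sinst-1-g11/stage73/HodgeCM/Model/AdelicThetaSlotTorusScalarW.lean`,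 md5 52ed2b8be09a, 131 lines);
landed by the gen-31 packager (p-g31) in gate run 73 as `HodgeCM/Model/AdelicThetaSlotTorusScalarW.lean` (verbatim).
-/
/-
Copyright (c) 2026 the pub-hodgecm formalisation cell (harness21).  New file, not vendored.
Origin: session prover-pub-hodgecm-mc-sinst-1-g11-0 (unit pub-hodgecm-mc-sinst-1-g11, S-INSTANCE CONSTRUCTOR gen 11; the `W`-SLOT of the twisted
slot characters at the det-twist η of record — the kernel form of sinst-1's precision to JOINT LINE (a) (STATUS 2026-08-21T04:27:24Z): carch's torus
scalars `torusScalar_kG (etaT_k …)` READ `χ_W` (covariantly), while the `V`-characters `lineCharV_k = adelicChar_k` do not (own-mu #MU3)), 2026-08-21.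
Intended final place: `HodgeCM/Model/AdelicThetaSlotTorusScalarW.lean` (NEW additive model-layer leaf; imports carch #CA60-era `Model/ArchKTypeOfTorus`,
period-1 `Model/ArchSideOfTwist34`, sinst-1 `Model/ThetaAdelicSideEta`; nothing imports it; drop alone).
-/
import Summits.HodgeConjecture.HodgeCM.Model.ArchKTypeOfTorus
import Summits.HodgeConjecture.HodgeCM.Model.ArchSideOfTwist34
import Summits.HodgeConjecture.HodgeCM.Model.ThetaAdelicSideEta

set_option autoImplicit false

/-!
# The torus scalars of the four twisted slot characters read the `W`-character: `torusScalar_kG (etaT_k ((χ_V∘det) ⊠ (χ_W∘det)) ν) u = χ_W(u) · χ_k(1, u·1)`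

For the det-twist form `η = cmDetTwistChar … χV χW` (= `EtaChi.η χV χW V c` at E's families) and any twist `ν` ∕ `ν′`:
* `etaT₀∕₁_apply_one_snd`, `etaT₂∕₃_apply_one_snd`: on `1 × U(1)` the twists `ν`, `ν′` drop out — `etaT_k η ν (1, u) = eta_k η (1, u)`;
* **`torusScalar_{zero,one,two,three}G_etaT_detTwist_apply`**: `torusScalar_kG … (etaT_k (cmDetTwistChar … χV χW) ν) u = χW u · χ_k(1, CMCenter u)`
  (carch `torusScalar_k_applyG` + `eta_k_detTwist_apply`), i.e. the torus scalar — hence sinst-1's `cW_kG`, `psi_kG`, `char_kDictG` and the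
  `hχinf` identity — is `χ_W`-COVARIANT: for two `W`-characters the scalars differ by the factor `χW u · (χW' u)⁻¹`
  (`torusScalar_{…}G_etaT_detTwist_eq_mul_of_chiW`).  Together with own-mu #MU3 (`lineCharV_k` is `χ_W`-free) this is the complete `χ_W`-bookkeeping
  of the (J4) chain at the pin of record.
KERNEL only: 0 records, 0 `def … : Prop`, nothing cited as a hypothesis; `#print axioms` ⊆ {propext, Classical.choice, Quot.sound}.
-/

noncomputable section

open NumberField
open scoped Matrix
open Literature.NumberTheory.Automorphic Literature.NumberTheory.Weil1964
open Literature.NumberTheory.GelbartRogawski1991 Literature.NumberTheory.GelbartRogawski1991.UnitaryDualPair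
open HodgeCM.Adelic HodgeCM.PerL34

namespace HodgeCM.Model.ArchSideTerm

variable {L : CMField} {ι₁ : L →+* ℂ} (V : HermSpace3 L ι₁) (S : StubTree.SeesawDatum L)
  (hGR : (cmSplittingDatum (L : Type) finProdFinEquiv (frameD V) (frameD_real V) (frameD_ne V) (dW S) (dW_real S) (dW_ne S)).CompatibleSplitting)
  (hGR₀ : (cmSplittingDatum (L : Type) (e₁) (frameD V) (frameD_real V) (frameD_ne V) (lineVec (L : Type) (dW S 0))
    (fun _ => dW_real S 0) (fun _ => dW_ne S 0)).CompatibleSplitting)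
  (hGR₁ : (cmSplittingDatum (L : Type) (e₁) (frameD V) (frameD_real V) (frameD_ne V) (lineVec (L : Type) (dW S 1))
    (fun _ => dW_real S 1) (fun _ => dW_ne S 1)).CompatibleSplitting)
  (hGR₂ : (cmSplittingDatum (L : Type) (e₁) (frameD V) (frameD_real V) (frameD_ne V) (lineVec (L : Type) (dW' S 0))
    (fun _ => dW'_real S 0) (fun _ => dW'_ne S 0)).CompatibleSplitting)
  (hGR₃ : (cmSplittingDatum (L : Type) (e₁) (frameD V) (frameD_real V) (frameD_ne V) (lineVec (L : Type) (dW' S 1))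
    (fun _ => dW'_real S 1) (fun _ => dW'_ne S 1)).CompatibleSplitting)
  (η : CMAdelic (L : Type) (frameD V) × CMAdelic (L : Type) (dW S) →* ℂˣ) (ν ν' : CMAdelic (L : Type) (frameD V) →* ℂˣ)
  (χV χW χW' : CMAdelicOne (L : Type) →* ℂˣ)

/-! ## § 1. On `1 × U(1)` the `V`-twists drop out -/

/-- (Ported verbatim from the HodgeCMPerL package; no docstring in the source.) -/
theorem etaT₀_apply_one_snd (u : CMAdelicOne (L : Type)) : etaT₀ V S η ν (1, u) = eta₀ V S η (1, u) := by
  rw [etaT₀_apply]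
  simp only [map_one, inv_one, one_mul]

/-- (Ported verbatim from the HodgeCMPerL package; no docstring in the source.) -/
theorem etaT₁_apply_one_snd (u : CMAdelicOne (L : Type)) : etaT₁ V S η ν (1, u) = eta₁ V S η (1, u) := by
  rw [etaT₁_apply]
  simp only [map_one, one_mul]

/-- (Ported verbatim from the HodgeCMPerL package; no docstring in the source.) -/
theorem etaT₂_apply_one_snd (u : CMAdelicOne (L : Type)) : etaT₂ V S η ν' (1, u) = eta₂ V S η (1, u) := by
  rw [etaT₂_apply]
  simp only [map_one, inv_one, one_mul]

/-- (Ported verbatim from the HodgeCMPerL package; no docstring in the source.) -/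
theorem etaT₃_apply_one_snd (u : CMAdelicOne (L : Type)) : etaT₃ V S η ν' (1, u) = eta₃ V S η (1, u) := by
  rw [etaT₃_apply]
  simp only [map_one, one_mul]

/-! ## § 2. The torus scalars at the det-twist η read `χ_W` -/

/-- **`torusScalar_zeroG (etaT₀ ((χ_V∘det) ⊠ (χ_W∘det)) ν) u = χ_W(u) · χ₀(1, u·1_{⟨a₀⟩})`.** -/
theorem torusScalar_zeroG_etaT_detTwist_apply (u : CMAdelicOne (L : Type)) :
    torusScalar_zeroG V S hGR hGR₀ hGR₁ (etaT₀ V S (cmDetTwistChar (L : Type) (frameD V) (frameD_ne V) (dW S) (dW_ne S) χV χW) ν) u =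
      χW u * cmLineChar₀ (L : Type) finProdFinEquiv e₁ (frameD V) (frameD_real V) (frameD_ne V) (dW S) (dW_real S) (dW_ne S) hGR hGR₀ hGR₁
        (1, CMCenter (L : Type) (lineVec (L : Type) (dW S 0)) u) := by
  rw [torusScalar_zero_applyG, etaT₀_apply_one_snd, eta₀_detTwist_apply, map_one, map_one, one_mul]

/-- **`torusScalar_oneG (etaT₁ ((χ_V∘det) ⊠ (χ_W∘det)) ν) u = χ_W(u) · χ₁(1, u·1_{⟨a₁⟩})`.** -/
theorem torusScalar_oneG_etaT_detTwist_apply (u : CMAdelicOne (L : Type)) :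
    torusScalar_oneG V S hGR hGR₀ hGR₁ (etaT₁ V S (cmDetTwistChar (L : Type) (frameD V) (frameD_ne V) (dW S) (dW_ne S) χV χW) ν) u =
      χW u * cmLineChar₁ (L : Type) finProdFinEquiv e₁ (frameD V) (frameD_real V) (frameD_ne V) (dW S) (dW_real S) (dW_ne S) hGR hGR₀ hGR₁
        (1, CMCenter (L : Type) (lineVec (L : Type) (dW S 1)) u) := by
  rw [torusScalar_one_applyG, etaT₁_apply_one_snd, eta₁_detTwist_apply]

/-- **`torusScalar_twoG (etaT₂ ((χ_V∘det) ⊠ (χ_W∘det)) ν′) u = χ_W(u) · χ₂′(1, u·1_{⟨a₂⟩})`** (conjugated plane). -/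
theorem torusScalar_twoG_etaT_detTwist_apply (u : CMAdelicOne (L : Type)) :
    torusScalar_twoG V S hGR hGR₂ hGR₃ (etaT₂ V S (cmDetTwistChar (L : Type) (frameD V) (frameD_ne V) (dW S) (dW_ne S) χV χW) ν') u =
      χW u * cmConjLineChar₀ (L : Type) finProdFinEquiv e₁ (frameD V) (frameD_real V) (frameD_ne V) (dW S) (dW_real S) (dW_ne S)
        (dW' S) (dW'_real S) (dW'_ne S) S.isoGL (isoGL_hg₀ S) hGR hGR₂ hGR₃ (1, CMCenter (L : Type) (lineVec (L : Type) (dW' S 0)) u) := by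
  rw [torusScalar_two_applyG, etaT₂_apply_one_snd, eta₂_detTwist_apply, map_one, map_one, one_mul]

/-- **`torusScalar_threeG (etaT₃ ((χ_V∘det) ⊠ (χ_W∘det)) ν′) u = χ_W(u) · χ₃′(1, u·1_{⟨a₃⟩})`** (conjugated plane). -/
theorem torusScalar_threeG_etaT_detTwist_apply (u : CMAdelicOne (L : Type)) :
    torusScalar_threeG V S hGR hGR₂ hGR₃ (etaT₃ V S (cmDetTwistChar (L : Type) (frameD V) (frameD_ne V) (dW S) (dW_ne S) χV χW) ν') u =
      χW u * cmConjLineChar₁ (L : Type) finProdFinEquiv e₁ (frameD V) (frameD_real V) (frameD_ne V) (dW S) (dW_real S) (dW_ne S)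
        (dW' S) (dW'_real S) (dW'_ne S) S.isoGL (isoGL_hg₀ S) hGR hGR₂ hGR₃ (1, CMCenter (L : Type) (lineVec (L : Type) (dW' S 1)) u) := by
  rw [torusScalar_three_applyG, etaT₃_apply_one_snd, eta₃_detTwist_apply]

/-! ## § 3. `χ_W`-covariance: two `W`-characters change the torus scalars by `χ_W(u) · χ_W′(u)⁻¹` -/

/-- **slot 0**: `torusScalar_zeroG (etaT₀ (… χW) ν) u = χW u · (χW′ u)⁻¹ · torusScalar_zeroG (etaT₀ (… χW′) ν) u`. -/
theorem torusScalar_zeroG_etaT_detTwist_eq_mul_of_chiW (u : CMAdelicOne (L : Type)) :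
    torusScalar_zeroG V S hGR hGR₀ hGR₁ (etaT₀ V S (cmDetTwistChar (L : Type) (frameD V) (frameD_ne V) (dW S) (dW_ne S) χV χW) ν) u =
      χW u * (χW' u)⁻¹ *
        torusScalar_zeroG V S hGR hGR₀ hGR₁ (etaT₀ V S (cmDetTwistChar (L : Type) (frameD V) (frameD_ne V) (dW S) (dW_ne S) χV χW') ν) u := by
  rw [torusScalar_zeroG_etaT_detTwist_apply, torusScalar_zeroG_etaT_detTwist_apply, mul_assoc, inv_mul_cancel_left]

/-- **slot 1**. -/
theorem torusScalar_oneG_etaT_detTwist_eq_mul_of_chiW (u : CMAdelicOne (L : Type)) :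
    torusScalar_oneG V S hGR hGR₀ hGR₁ (etaT₁ V S (cmDetTwistChar (L : Type) (frameD V) (frameD_ne V) (dW S) (dW_ne S) χV χW) ν) u =
      χW u * (χW' u)⁻¹ *
        torusScalar_oneG V S hGR hGR₀ hGR₁ (etaT₁ V S (cmDetTwistChar (L : Type) (frameD V) (frameD_ne V) (dW S) (dW_ne S) χV χW') ν) u := by
  rw [torusScalar_oneG_etaT_detTwist_apply, torusScalar_oneG_etaT_detTwist_apply, mul_assoc, inv_mul_cancel_left]

/-- **slot 2**. -/
theorem torusScalar_twoG_etaT_detTwist_eq_mul_of_chiW (u : CMAdelicOne (L : Type)) :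
    torusScalar_twoG V S hGR hGR₂ hGR₃ (etaT₂ V S (cmDetTwistChar (L : Type) (frameD V) (frameD_ne V) (dW S) (dW_ne S) χV χW) ν') u =
      χW u * (χW' u)⁻¹ *
        torusScalar_twoG V S hGR hGR₂ hGR₃ (etaT₂ V S (cmDetTwistChar (L : Type) (frameD V) (frameD_ne V) (dW S) (dW_ne S) χV χW') ν') u := by
  rw [torusScalar_twoG_etaT_detTwist_apply, torusScalar_twoG_etaT_detTwist_apply, mul_assoc, inv_mul_cancel_left]

/-- **slot 3**. -/
theorem torusScalar_threeG_etaT_detTwist_eq_mul_of_chiW (u : CMAdelicOne (L : Type)) :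
    torusScalar_threeG V S hGR hGR₂ hGR₃ (etaT₃ V S (cmDetTwistChar (L : Type) (frameD V) (frameD_ne V) (dW S) (dW_ne S) χV χW) ν') u =
      χW u * (χW' u)⁻¹ *
        torusScalar_threeG V S hGR hGR₂ hGR₃ (etaT₃ V S (cmDetTwistChar (L : Type) (frameD V) (frameD_ne V) (dW S) (dW_ne S) χV χW') ν') u := by
  rw [torusScalar_threeG_etaT_detTwist_apply, torusScalar_threeG_etaT_detTwist_apply, mul_assoc, inv_mul_cancel_left]

end HodgeCM.Model.ArchSideTerm

end
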